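import Summits.FinalStateConjecture.FinalStateConjecture.Theorems.ZeroEnergyKerrOrBombStationaryLimitReductionKerrIsometryRigidityWave3Facts
import Summits.FinalStateConjecture.FinalStateConjecture.Theorems.ZeroEnergyKerrOrBombStationaryLimitReductionKerrIsometryRigidityWave3ChartMap
import Literature.Geometry.Lorentzian.KerrHyperboloidalLeaves
import HarnessLib

/-!
# Route ZeroEnergyKerrOrBomb · crux `FinalStateFromKerrOrBomb` (stmt-FinalStateConjecture-17839), line
# `SketchIdeator1` — stub 1R-F3 `stub_kerrHorizonExtension`: the SOFT HALF of the horizon extension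
# (`KerrHorizonExtension` from chart-level boundary regularity of `Θ = A⁻¹ ∘ Ψ` at `r = r₊`)

Helper file (`--supports stmt-FinalStateConjecture-17839`; registered helper
`kerrHorizonExtension_of_boundaryRegularity`) of the lead's wave-2 stub-worker for
`stub_kerrHorizonExtension : SigM.stub_kerrHorizonExtension := KerrHorizonExtension` (F3 of stub 1R,
`…KerrIsometryRigidityWave3Facts`, p125844; lead prover-line-stmt-FinalStateConjecture-17839-0, 2026-08-17).

**What F3 says.** For a telescope hole `𝓑`, `I⁺`-regular, read in a horizon-covering asymptotically Cartesian
adapted chart `A`, a future-normalised `T`-equivariant injective isometric immersion `Ψ` of the sub-extremal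
Kerr exterior onto the d.o.c. (`dΨ (∂_{t*}) = c T`, `c > 0`) extends to a map `Φ : {r > r₀} → 𝓑`
(`r₋ < r₀ < r₊`, ingoing Kerr–Schild region) which is `C^∞` and injective, valued in `range A`,
infinitesimally `T`-equivariant and equal to `Ψ` on `{r > r₊}`.

**Audit (this worker).** (i) No junk witness: `Φ = Ψ` on the open exterior and `Φ` continuous on
`{r > r₀} ∋ {r = r₊}` pin `Φ|_{r ≥ r₊}` to THE continuous extension of `Ψ`, and injectivity forces the collar
`{r₀ < r ≤ r₊}` into `range A ∖ ⟨⟨M_ext⟩⟩ = range A ∩ 𝓑⁺` (black-hole side); a radial squeeze `Ψ ∘ ρ`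
violates `Φ = Ψ` on the exterior. (ii) The chart `A` is immaterial to the truth of F3: `Φ` is valued in
`𝓑`, and `A⁻¹` is a diffeomorphism of the open `T`-invariant set `range A ⊇ ⟨⟨M_ext⟩⟩ ∪ 𝓔⁺` onto
`A.domain` (clause (3) of `ChartIsAsymptoticallyCartesian`, `contMDiffOn_adaptedChart_symm`), so
"`A⁻¹ ∘ Ψ` stays in a compact part of the chart along `{t* = 0, r ↓ r₊}`" is EQUIVALENT to "`Ψ (0, y)`
converges in `𝓑` to a point of `𝓔⁺` as `r(y) ↓ r₊`", whatever the leaves of `A` look like. Future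
normalisation is the right hypothesis: `Ψ_* ∂_{t*} = c T`, `c > 0`, with `∂_{t*}` and `T` future timelike far
out makes `Ψ` time-orientation preserving (the F5 mechanism, p135232), so limits of `Ψ` along future causal
curves leaving the exterior through Kerr's `𝓗⁺ = {r = r₊}` (regular in INGOING Kerr–Schild coordinates) lie,
when they exist, in `J⁺(⟨⟨M_ext⟩⟩) ∩ ∂I⁻(M_ext) = 𝓔⁺`; the opposite normalisation would send them towards
`𝓔⁻`, absent from a future-presented hole. On Kerr itself (`𝓑` = the ingoing Kerr–Schild region `{r > r₀'}`
of `Kerr (M, a)`, any admissible `A`) F3 holds with `c = 1` forced: an isometry of block I with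
`Ψ_* ∂_{t*} = c ∂_{t*}`, `c > 0`, is `∂_t ⊕ ∂_φ`-flow ∘ (equatorial reflection), which extends across `𝓗⁺`
(O'Neill 1995, §3.1, §3.7), and `range A ⊇ 𝓗⁺` is `t*`-invariant hence contains a uniform collar. So F3
is NOT misstated; its content is genuinely the unprinted `C^∞` boundary regularity of the d.o.c. isometry
at `𝓔⁺` under `I⁺`-regularity (existence of the limits = completeness of `𝓔⁺`, Chruściel–Costa 2008 §4.1–4.3,
Prop. 4.1–4.8, Thm. 4.11; smoothness = isometries commute with `exp` across the smooth null hypersurface).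

**What is proved here (the soft half).** `kerrHorizonExtension_of_boundaryRegularity`: IF the chart reading
`Θ := chartPreimage A ∘ Ψ` of `Ψ` extends to a map `Θ : E4 → E4` which, on SOME horizon-penetrating region
`{r > r₁}` (`r₁ < r₊`), is `C^∞`, injective and `T`-equivariant (`Θ (x + s e₀) = Θ x + (c s) e₀`) and sends
the horizon `{r = r₊}` into `A.domain` (hypothesis F3a, stated inline, no new definition), THEN
`KerrHorizonExtension` holds: (1) a collar lemma (`exists_collar_mem`, Bolzano–Weierstrass on the compact
slice `{x⁰ = 0, r = r₊}` + continuity + openness of `A.domain`) gives `ε > 0` with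
`Θ {x⁰ = 0, r₊ − ε < r ≤ r₊} ⊆ A.domain`; (2) time invariance of the Kerr–Schild radius, of `A.domain` and
the equivariance of `Θ` spread this to all `x⁰`; (3) with `r₀ := max (r₁, (r₋ + r₊)/2, r₊ − ε)` the map
`Φ := A ∘ Θ` on `{r > r₀}` is `C^∞` (chain rule through the open submanifold `A.domain`), injective (`A` is),
valued in `range A`, satisfies `dΦ e₀ = dA (dΘ e₀) = dA (c e₀) = c T` (`AdaptedChart.mfderiv_toFun_basisVector`)
and `Φ = A ∘ A⁻¹ ∘ Ψ = Ψ` on the exterior (`chartPreimage_spec`). The residual of F3 is exactly F3a.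

References: P. T. Chruściel, J. L. Costa, arXiv:0806.0016, Thm. 1.3, §4.1–4.3 (Prop. 4.1–4.8, Thm. 4.11);
B. O'Neill, *The Geometry of Kerr Black Holes* (1995), §3.1, §3.7; B. O'Neill, *Semi-Riemannian Geometry*
(1983), Ch. 1, Thm. 1.16, Ch. 3, pp. 58–59, 90–91; J. M. Lee, *Introduction to Smooth Manifolds* (2013),
Prop. 3.9.
-/

set_option linter.dupNamespace false

noncomputable section

open scoped Manifold ContDiff Topology
open Set Filter Function

namespace Summit.FinalStateConjecture.FinalStateConjecture.Theorems.SymplecticDualOfTheBomb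

open Summit.FinalStateConjecture.FinalStateConjecture.Theorems.OneLockedExplosion
open Literature.Geometry.Lorentzian Literature.Geometry.Manifold

/-! ## §1 Chain rule through the adapted chart (private copies of p135232, module unbuilt today) -/

section Comp

variable {𝓑 : StationaryAFBlackHole.{0}} (A : 𝓑.AdaptedChart) {S : Set E4} {Θ : E4 → E4}
  {φ : E4 → A.domain}

/-- Chain rule through the open submanifold `A.domain`: if `φ : E4 → A.domain` corestricts `Θ` on the open
set `S` and `Θ` is differentiable at `x ∈ S`, then `A ∘ φ` has manifold derivative `dA_{φ x} ∘ dΘ_x` at `x`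
(Lee 2013, Prop. 3.9: `T_p U = T_p M`). Private copy of `hasMFDerivAt_adaptedChart_comp` (p135232,
`…FinalStateFromKerrOrBombKerrIdentificationFuture`, not yet built). [folklore] -/
private theorem hasMFDerivAt_adaptedChart_comp' (hS : IsOpen S) (hφ : ∀ x ∈ S, (φ x : E4) = Θ x)
    {x : E4} (hx : x ∈ S) (hd : DifferentiableAt ℝ Θ x) :
    HasMFDerivAt 𝓘(ℝ, E4) (𝓡 4) (A.toFun ∘ φ) x
      ((mfderiv 𝓘(ℝ, E4) (𝓡 4) A.toFun (φ x)).comp (fderiv ℝ Θ x)) := by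
  -- private copy of `hasMFDerivAt_adaptedChart_comp` (p135232)
  have h1 : HasMFDerivAt 𝓘(ℝ, E4) 𝓘(ℝ, E4) (Subtype.val ∘ φ) x (fderiv ℝ Θ x) :=
    (hasMFDerivAt_iff_hasFDerivAt.2 hd.hasFDerivAt).congr_of_eventuallyEq
      (Filter.eventuallyEq_of_mem (hS.mem_nhds hx) fun y hy ↦ hφ y hy)
  have h2 : HasMFDerivAt 𝓘(ℝ, E4) 𝓘(ℝ, E4) φ x (fderiv ℝ Θ x) :=
    OpensChart.hasMFDerivAt_codRestrict (f := Subtype.val ∘ φ) (fun _ ↦ rfl) h1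
  have h3 : HasMFDerivAt 𝓘(ℝ, E4) (𝓡 4) A.toFun (φ x) (mfderiv 𝓘(ℝ, E4) (𝓡 4) A.toFun (φ x)) :=
    (A.contMDiff.mdifferentiableAt (by simp)).hasMFDerivAt
  exact h3.comp x h2

/-- Pointwise chain rule `d(A ∘ φ)_x v = dA_{φ x} (dΘ_x v)` (Lee 2013, Prop. 3.9). Private copy of
`mfderiv_adaptedChart_comp_apply` (p135232). [folklore] -/
private theorem mfderiv_adaptedChart_comp_apply' (hS : IsOpen S) (hφ : ∀ x ∈ S, (φ x : E4) = Θ x)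
    {x : E4} (hx : x ∈ S) (hd : DifferentiableAt ℝ Θ x) (v : E4) :
    mfderiv 𝓘(ℝ, E4) (𝓡 4) (A.toFun ∘ φ) x v =
      mfderiv 𝓘(ℝ, E4) (𝓡 4) A.toFun (φ x) (fderiv ℝ Θ x v) := by
  rw [(hasMFDerivAt_adaptedChart_comp' A hS hφ hx hd).mfderiv]
  rfl

/-- `A ∘ φ` is `C^∞` on `S` when `Θ` is (corestriction to an open submanifold,
`ContMDiffAt.subtypeVal_comp_iff`, composed with the smooth chart map; Lee 2013, Prop. 3.9). Private copy
of `contMDiffOn_adaptedChart_comp` (p135232). [folklore] -/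
private theorem contMDiffOn_adaptedChart_comp' (hS : IsOpen S) (hφ : ∀ x ∈ S, (φ x : E4) = Θ x)
    (hΘ : ContDiffOn ℝ ∞ Θ S) : ContMDiffOn 𝓘(ℝ, E4) (𝓡 4) ∞ (A.toFun ∘ φ) S := by
  refine A.contMDiff.comp_contMDiffOn fun x hx ↦ ContMDiffAt.contMDiffWithinAt ?_
  have h1 : ContMDiffAt 𝓘(ℝ, E4) 𝓘(ℝ, E4) ∞ (Subtype.val ∘ φ) x :=
    (contMDiffAt_iff_contDiffAt.2 (hΘ.contDiffAt (hS.mem_nhds hx))).congr_of_eventuallyEq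
      (Filter.eventuallyEq_of_mem (hS.mem_nhds hx) fun y hy ↦ hφ y hy)
  exact (ContMDiffAt.subtypeVal_comp_iff A.domain φ x).1 h1

end Comp

/-! ## §2 The collar lemma: a charted horizon has a charted collar on the slice `{x⁰ = 0}` -/

/-- `‖x⃗‖² ≤ r² + a²` for the Kerr–Schild radius (`r² = ((ρ² − a²) + √((ρ² − a²)² + 4a²z²))/2` and
`√(⋯) ≥ |ρ² − a²|`; Visser arXiv:0706.0622, (35)). Same as `Kerr.spatialNorm_sq_sub_sq_le_radius_sq` of
`KerrWaveEnergy.lean`, reproved to keep the import cone small. [folklore] -/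
private theorem sq_spatialNorm_le_radius_sq_add (a : ℝ) (x : E4) :
    E4.spatialNorm x ^ 2 ≤ Kerr.radius a x ^ 2 + a ^ 2 := by
  rw [Kerr.radius_sq]
  linarith [Kerr.abs_le_sqrt_radius_discr a x, le_abs_self (E4.spatialNorm x ^ 2 - a ^ 2)]

/-- **Collar lemma.** Let `Θ` be continuous on the Kerr–Schild region `{r > max r₁ 0}` with
`max r₁ 0 < r_p`, and let `W ⊆ E4` be open with `Θ {r = r_p} ⊆ W`. Then for some `ε > 0` every slice
point `(0, y)` with `r_p − ε < r (0, y) ≤ r_p` has `Θ (0, y) ∈ W`. Proof: otherwise there are slice points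
`(0, yₙ)`, `r_p − 1/(n+1) < r ≤ r_p`, with `Θ (0, yₙ) ∉ W`; they are bounded (`‖y‖² ≤ r² + a²`), a
subsequence converges (Bolzano–Weierstrass) to `(0, y₀)` with `r (0, y₀) = r_p`, where `Θ (0, y₀) ∈ W` and
`Θ` is continuous — contradiction with the openness of `W`. [folklore] -/
private theorem exists_collar_mem {a r₁ rp : ℝ} {Θ : E4 → E4} {W : Set E4} (hW : IsOpen W)
    (hr₁ : max r₁ 0 < rp) (hΘc : ContinuousOn Θ (Kerr.region a r₁ : Set E4))
    (hhor : ∀ x ∈ (Kerr.region a r₁ : Set E4), Kerr.radius a x = rp → Θ x ∈ W) :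
    ∃ ε : ℝ, 0 < ε ∧ ∀ y : E3, rp - ε < Kerr.radius a (E4.ofTimeSpace 0 y) →
      Kerr.radius a (E4.ofTimeSpace 0 y) ≤ rp → Θ (E4.ofTimeSpace 0 y) ∈ W := by
  by_contra! hcon
  choose y hylow hyle hyW using fun n : ℕ ↦ hcon (1 / ((n : ℝ) + 1)) (by positivity)
  -- the sequence is bounded
  set R : ℝ := √(rp ^ 2 + a ^ 2) with hR
  have hyR : ∀ n, y n ∈ Metric.closedBall (0 : E3) R := by
    intro n
    rw [Metric.mem_closedBall, dist_zero_right]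
    have h1 := sq_spatialNorm_le_radius_sq_add a (E4.ofTimeSpace 0 (y n))
    rw [E4.spatialNorm_ofTimeSpace] at h1
    have h2 : Kerr.radius a (E4.ofTimeSpace 0 (y n)) ^ 2 ≤ rp ^ 2 :=
      pow_le_pow_left₀ (Kerr.radius_nonneg a _) (hyle n) 2
    calc ‖y n‖ ≤ |‖y n‖| := le_abs_self _
      _ ≤ R := Real.abs_le_sqrt (by linarith)
  -- a convergent subsequence and its limit on the horizon
  obtain ⟨y₀, -, φ, hφ, hlim⟩ := tendsto_subseq_of_bounded Metric.isBounded_closedBall hyR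
  set x₀ : E4 := E4.ofTimeSpace 0 y₀ with hx₀
  have hxlim : Tendsto (fun n ↦ E4.ofTimeSpace 0 (y (φ n))) atTop (𝓝 x₀) :=
    ((E4.continuous_ofTimeSpace 0).tendsto y₀).comp hlim
  have hrlim : Tendsto (fun n ↦ Kerr.radius a (E4.ofTimeSpace 0 (y (φ n)))) atTop
      (𝓝 (Kerr.radius a x₀)) :=
    ((Kerr.continuous_radius a).tendsto x₀).comp hxlim
  have hεlim : Tendsto (fun n ↦ rp - 1 / ((φ n : ℝ) + 1)) atTop (𝓝 (rp - 0)) :=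
    tendsto_const_nhds.sub (tendsto_one_div_add_atTop_nhds_zero_nat.comp hφ.tendsto_atTop)
  rw [sub_zero] at hεlim
  have hr₀ : Kerr.radius a x₀ = rp :=
    le_antisymm (le_of_tendsto' hrlim fun n ↦ hyle (φ n))
      (le_of_tendsto_of_tendsto' hεlim hrlim fun n ↦ (hylow (φ n)).le)
  have hx₀S : x₀ ∈ (Kerr.region a r₁ : Set E4) := by
    show max r₁ 0 < Kerr.radius a x₀
    rw [hr₀]
    exact hr₁
  have hΘx₀ : Θ x₀ ∈ W := hhor x₀ hx₀S hr₀
  have hcont : ContinuousAt Θ x₀ := hΘc.continuousAt ((Kerr.region a r₁).isOpen.mem_nhds hx₀S)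
  have hev : ∀ᶠ n in atTop, Θ (E4.ofTimeSpace 0 (y (φ n))) ∈ W :=
    (hcont.tendsto.comp hxlim).eventually_mem (hW.mem_nhds hΘx₀)
  obtain ⟨n, hn⟩ := hev.exists
  exact hyW (φ n) hn

/-! ## §3 The registered reduction: F3a (chart-level boundary regularity) implies `KerrHorizonExtension` -/

/-- **Registered helper `kerrHorizonExtension_of_boundaryRegularity`** (the soft half of stub 1R-F3).
HYPOTHESIS F3a (inline): under the hypotheses of `KerrHorizonExtension` (telescope hole `𝓑`, `I⁺`-regular,
horizon-covering asymptotically Cartesian adapted chart `A`, sub-extremal `(M, a)`, `c > 0`, `Ψ` an injective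
isometric immersion of the Kerr exterior onto the d.o.c. with `dΨ (∂_{t*}) = c T`), the chart reading
`chartPreimage A ∘ Ψ` extends to `Θ : E4 → E4` which on some horizon-penetrating Kerr–Schild region
`{r > r₁}`, `r₁ < r₊`, is `C^∞`, injective, `T`-equivariant (`Θ (x + s e₀) = Θ x + (c s) e₀`), and sends
the horizon `{r = r₊}` into `A.domain` — the `C^∞` boundary regularity of the d.o.c. isometry at the future
event horizon read in horizon-regular charts, plus an injective equivariant continuation into a collar
(injectivity on `{r > r₁}` unpacks as: injectivity of `A⁻¹ ∘ Ψ` on the exterior, which is free; local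
injectivity at the horizon, e.g. from `dΘ` non-degenerate there; and "the continuation enters the black-hole
side", `Θ {r₁ < r ≤ r₊} ∩ A⁻¹(⟨⟨M_ext⟩⟩) = ∅` — the last two are part of the same boundary analysis, so
nothing soft is hidden in the clause). CONCLUSION: `KerrHorizonExtension`. Proof: the collar lemma `exists_collar_mem` on the slice `{x⁰ = 0}`
(compactness of `{x⁰ = 0, r = r₊}`, continuity of `Θ`, openness of `A.domain`), spread to all `x⁰` by the
time invariance of the Kerr–Schild radius (`Kerr.radius_add_time_smul_basisVector`) and of `A.domain`
(`add_smul_basisVector_mem_domain`) and by the equivariance of `Θ` (`apply_eq_apply_foot_add`), gives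
`Θ {r > r₀} ⊆ A.domain` for `r₀ := max (r₁, (r₋ + r₊)/2, r₊ − ε)`; then `Φ := A ∘ Θ` is `C^∞` (chain rule
through the open submanifold `A.domain`), injective (`A` is an embedding), valued in `range A`, has
`dΦ e₀ = dA (dΘ e₀) = dA (c e₀) = c T` (`fderiv_apply_basisVector_zero_of_contDiffOn`,
`AdaptedChart.mfderiv_toFun_basisVector`) and equals `A ∘ A⁻¹ ∘ Ψ = Ψ` on the exterior
(`chartPreimage_spec`, `𝓑.doc ⊆ range A`). O'Neill 1983, Ch. 1, Thm. 1.16 and Ch. 3, pp. 58–59;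
Chruściel–Costa arXiv:0806.0016, Thm. 1.3 with §4.3 (the shape of F3). [folklore] -/
theorem kerrHorizonExtension_of_boundaryRegularity : (∀ [Kerr.Facts] (𝓑 : StationaryAFBlackHole.{0}) (A : 𝓑.AdaptedChart) (M a c : ℝ) (Ψ : Kerr.exterior M a → 𝓑.carrier), InTelescope 𝓑 → 𝓑.IsIPlusRegular → 𝓑.horizon ⊆ Set.range A.toFun → ChartIsAsymptoticallyCartesian A → Kerr.IsSubextremal M a → 0 < c → Function.Injective Ψ → Set.range Ψ = 𝓑.doc → PseudoRiemannianMetric.IsIsometricImmersion (Kerr.smoothMetric M a (Kerr.rPlus M a)).toPseudoRiemannianMetric 𝓑.metric.toPseudoRiemannianMetric Ψ → (∀ x : Kerr.exterior M a, mfderiv 𝓘(ℝ, E4) (𝓡 4) Ψ x (E4.basisVector 0) = c • 𝓑.killing (Ψ x)) → ∃ (r₁ : ℝ) (Θ : E4 → E4), r₁ < Kerr.rPlus M a ∧ ContDiffOn ℝ ∞ Θ (Kerr.region a r₁ : Set E4) ∧ Set.InjOn Θ (Kerr.region a r₁ : Set E4) ∧ (∀ x ∈ (Kerr.region a r₁ :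 Set E4), ∀ s : ℝ, Θ (x + s • E4.basisVector 0) = Θ x + (c * s) • E4.basisVector 0) ∧ (∀ x ∈ (Kerr.region a r₁ : Set E4), Kerr.radius a x = Kerr.rPlus M a → Θ x ∈ A.domain) ∧ (∀ x : Kerr.exterior M a, Θ x.1 = chartPreimage A (Ψ x))) → KerrHorizonExtension := by
  intro hF3a hKF 𝓑 A M a c Ψ htel hreg hhor hcart hMa hc hΨi hΨr hΨiso hΨT
  obtain ⟨r₁, Θ, hr₁, hΘs, hΘi, hΘT, hΘhor, hΘΨ⟩ :=
    hF3a 𝓑 A M a c Ψ htel hreg hhor hcart hMa hc hΨi hΨr hΨiso hΨT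
  -- elementary facts on the radii and the regions
  have hrp0 : 0 < Kerr.rPlus M a := hMa.rMinus_nonneg.trans_lt hMa.rMinus_lt_rPlus
  have hr₁' : max r₁ 0 < Kerr.rPlus M a := max_lt hr₁ hrp0
  -- exterior points read back through the chart: `Θ x ∈ A.domain` and `A (Θ x) = Ψ x`
  have hext : ∀ x : Kerr.exterior M a, ∃ h : Θ x.1 ∈ A.domain, A.toFun ⟨Θ x.1, h⟩ = Ψ x := by
    intro x
    have hΨx : Ψ x ∈ Set.range A.toFun := by
      refine A.doc_subset_range ?_
      rw [← hΨr]
      exact Set.mem_range_self x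
    obtain ⟨hu, hAu⟩ := chartPreimage_spec A hΨx
    rw [hΘΨ x]
    exact ⟨hu, hAu⟩
  -- Step 1: a collar of the horizon on the slice `{x⁰ = 0}` is charted
  obtain ⟨ε, hε, hcollar⟩ := exists_collar_mem A.domain.isOpen hr₁' hΘs.continuousOn hΘhor
  -- Step 2: the inner radius `r₀`
  set r₀ : ℝ := max (max r₁ ((Kerr.rMinus M a + Kerr.rPlus M a) / 2)) (Kerr.rPlus M a - ε) with hr₀_def
  have hr₀lt : r₀ < Kerr.rPlus M a := by
    rw [hr₀_def]
    exact max_lt (max_lt hr₁ (by linarith [hMa.rMinus_lt_rPlus])) (by linarith)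
  have hr₀m : Kerr.rMinus M a < r₀ := by
    rw [hr₀_def]
    exact lt_of_lt_of_le (by linarith [hMa.rMinus_lt_rPlus]) ((le_max_right _ _).trans (le_max_left _ _))
  have hr₁₀ : r₁ ≤ r₀ := by
    rw [hr₀_def]
    exact (le_max_left _ _).trans (le_max_left _ _)
  have hε₀ : Kerr.rPlus M a - ε ≤ r₀ := by
    rw [hr₀_def]
    exact le_max_right _ _
  have hsub : (Kerr.region a r₀ : Set E4) ⊆ (Kerr.region a r₁ : Set E4) := Kerr.region_mono a hr₁₀
  have hS₀o : IsOpen (Kerr.region a r₀ : Set E4) := (Kerr.region a r₀).isOpen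
  -- Step 3: `Θ {r > r₀} ⊆ A.domain` (exterior: chart preimage; collar: Step 1 + time invariance)
  have hdom : ∀ x ∈ (Kerr.region a r₀ : Set E4), Θ x ∈ A.domain := by
    intro x hx
    by_cases hxr : Kerr.rPlus M a < Kerr.radius a x
    · exact (hext ⟨x, Kerr.mem_exterior.2 (max_lt hxr (Kerr.radius_pos_of_mem_region hx))⟩).1
    · have hxr' : Kerr.radius a x ≤ Kerr.rPlus M a := not_lt.mp hxr
      -- the foot `(0, y)` of `x = (t, y)` has the same radius
      have hrad := Kerr.radius_add_time_smul_basisVector a (E4.ofTimeSpace 0 (E4.spatial x)) (E4.time x)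
      rw [ofTimeSpace_zero_spatial_add_time_smul] at hrad
      have h0 : Θ (E4.ofTimeSpace 0 (E4.spatial x)) ∈ A.domain := by
        refine hcollar (E4.spatial x) ?_ ?_
        · rw [← hrad]
          linarith [Kerr.lt_radius_of_mem_region hx]
        · rw [← hrad]
          exact hxr'
      rw [apply_eq_apply_foot_add (kerrRegion_add_smul_mem a r₁) hΘT (hsub hx)]
      exact add_smul_basisVector_mem_domain A h0 _
  -- Step 4: the corestriction `φ` of `Θ` to `A.domain` and `Φ := A ∘ φ`
  obtain ⟨x₁, hx₁⟩ := kerrRegion_nonempty a (Kerr.rPlus M a)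
  obtain ⟨hΘx₁, -⟩ := hext ⟨x₁, hx₁⟩
  classical
  set φ : E4 → A.domain := fun x ↦ if h : Θ x ∈ A.domain then ⟨Θ x, h⟩ else ⟨Θ x₁, hΘx₁⟩ with hφ_def
  have hφ : ∀ x ∈ (Kerr.region a r₀ : Set E4), (φ x : E4) = Θ x := by
    intro x hx
    rw [hφ_def]
    dsimp only
    rw [dif_pos (hdom x hx)]
  refine ⟨r₀, A.toFun ∘ φ, hr₀m, hr₀lt, contMDiffOn_adaptedChart_comp' A hS₀o hφ (hΘs.mono hsub),
    ?_, fun x _ ↦ Set.mem_range_self (φ x), ?_, ?_⟩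
  · -- injective: `A` is an embedding and `Θ` is injective on `{r > r₁} ⊇ {r > r₀}`
    intro x hx y hy hxy
    have h1 : φ x = φ y := A.isOpenEmbedding.injective hxy
    have h2 : Θ x = Θ y := by rw [← hφ x hx, ← hφ y hy, h1]
    exact hΘi (hsub hx) (hsub hy) h2
  · -- infinitesimal `T`-equivariance: `dΦ e₀ = dA (dΘ e₀) = dA (c e₀) = c T`
    intro x hx
    have hd : DifferentiableAt ℝ Θ x :=
      ((hΘs.mono hsub).differentiableOn (by simp)).differentiableAt (hS₀o.mem_nhds hx)
    have he₀ : fderiv ℝ Θ x (E4.basisVector 0) = c • E4.basisVector 0 :=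
      fderiv_apply_basisVector_zero_of_contDiffOn hS₀o (by simp) (hΘs.mono hsub)
        (fun y hy s ↦ hΘT y (hsub hy) s) hx
    have h1 : mfderiv 𝓘(ℝ, E4) (𝓡 4) A.toFun (φ x) (c • E4.basisVector 0) =
        c • mfderiv 𝓘(ℝ, E4) (𝓡 4) A.toFun (φ x) (E4.basisVector 0) :=
      (mfderiv 𝓘(ℝ, E4) (𝓡 4) A.toFun (φ x)).map_smul c (E4.basisVector 0)
    rw [mfderiv_adaptedChart_comp_apply' A hS₀o hφ hx hd, he₀, h1, A.mfderiv_toFun_basisVector (φ x)]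
    rfl
  · -- agreement with `Ψ` on the exterior: `A (A⁻¹ (Ψ x)) = Ψ x`
    intro x
    obtain ⟨h, hA⟩ := hext x
    have hφx : φ x.1 = ⟨Θ x.1, h⟩ := by
      rw [hφ_def]
      dsimp only
      rw [dif_pos h]
    show A.toFun (φ x.1) = Ψ x
    rw [hφx]
    exact hA

end Summit.FinalStateConjecture.FinalStateConjecture.Theorems.SymplecticDualOfTheBomb

end
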